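import Summits.BirchSwinnertonDyer.BirchSwinnertonDyer.Theorems.KimAtThreeShallowEqDeepPositionRescaleDefs
import Summits.BirchSwinnertonDyer.BirchSwinnertonDyer.Theorems.KimAtThreeShallowEqDeepPositionScaling
import Summits.BirchSwinnertonDyer.BirchSwinnertonDyer.Theorems.KimAtThreeShallowEqDeepOfPeriodPositionItem
import HarnessLib

/-!
# Route `KimAtThreeKolyvagin` (W2): the route item 21401 `KatoPeriodPositionThree` is EQUIVALENT to its INEQUALITY form and to its
# «up to a power of 3» form (cell `bsd-addord`, seat w2-c4 gen 14; TOOL / reading-level theorems,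
# `--supports stmt-BirchSwinnertonDyer-19077`, helper — closes nothing)

HONEST FRAMING.  Composition / tool theorems only (no definition, no named fact, no instance, no `sorry`).  Item 21401
(`Theses.KimAtThreeKolyvagin.KatoPeriodPositionThree` := `KimAtThreeShallowEqDeepPositionDefs.KatoPeriodPositionAtThree`) is the W2
route's ONE displayed non-cite statement — its own hypothesis, STRONGER than Kato's theorem, print status PRE; it is NOT proved or
refuted here.  What is proved: it is EQUIVALENT to the two reformulations named in `KimAtThreeShallowEqDeepPositionRescaleDefs`
(w2-c4 gen 14), so the displayed EQUALITY `v_3(u) = v(ι_3 e)` in `KatoPosition` asks nothing beyond the INEQUALITY `v_3(u) ≤ v(ι_3 e)`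
— «Kato's constant is at most as 3-divisible as the duality-normalising scalar», i.e. the normalisation exponent `e(Ω⁺_f) ≥ 0` of crux
19077's docstring (w2-c4 gen 13 HANDOFF (iii) / w2-acc4 gen 7 (F2) «POS= ⟺ POS≤ inside the ∃», now a kernel theorem).  Nothing is
closed or booked; BSD is NOT proved by any of this.

WHAT.
* `exists_add_eq_of_le_of_rigid` — pure logic (an inequality against a rigid family of values is ONE natural shift away from equality).
* `katoPeriodPositionAtThree_iff_upToPow` — 21401 ⟺ `KatoPeriodPositionUpToPowAtThree` (rescale the datum by `3^m`:
  `KimAtThreeShallowEqDeepPositionScaling.definedExpStarBody_natCast_mul`).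
* `katoPeriodPositionAtThree_iff_le` — **21401 ⟺ `KatoPeriodPositionLEAtThree`** (rigidity of the duality scalar,
  `KimAtThreeShallowEqDeepPositionScaling.valuation_eq_of_forall_exists_eq_mul_iff_ball`, + the rescaling).
* `katoPeriodPositionThree_iff_le` / `katoPeriodPositionThree_iff_upToPow` — the same keyed on the ROUTE ITEM decl.
ENGINEERING NOTE (why the reformulations are `def`s of a Defs file and not spelled inline here): a `theorem` whose STATEMENT spells the
cross-application `Kato2004.DefinedExpStarBody W 3 P.f d …` at a `KatoPosition`-typed `d` exceeds the kernel heartbeat budget (> 30 min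
on the farm), while the byte-identical text as a `def : Prop` — and every PROOF that destructures / rebuilds it — elaborates in seconds
(seat finding 2026-08-27, four controlled farm runs; NOTES.md of the seat).
References: [Kato2004Asterisque] (8.1.3), Prop. 8.12, §9.4, Thm. 9.7, Thm. 6.6 (1), Ex. 13.3; [BlochKato1990] §3 (Def. 3.10,
Prop. 3.8, Ex. 3.11); [SilvermanAEC2009] IV.6.4, VII.6.3.
-/

set_option autoImplicit false

noncomputable section

-- the cell's Theorems namespace `Summit.BirchSwinnertonDyer.BirchSwinnertonDyer.…` repeats the summit name by design (D-0017)
set_option linter.dupNamespace false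

open scoped Classical NumberField TensorProduct
open Field IsDedekindDomain NumberField CongruenceSubgroup WeierstrassCurve
open Literature.NumberTheory.EllipticCurves
open Literature.NumberTheory.GaloisRepresentations
open Literature.NumberTheory.EllipticCurves.ModularForms
open Literature.NumberTheory.EllipticCurves.Kato2004 Literature.NumberTheory.EllipticCurves.Kato2004.EulerSystemValues
open Summit.BirchSwinnertonDyer.Rank1Residual.Additive.LocalLog
open Rat.HeightOneSpectrum
open Summit.BirchSwinnertonDyer.BirchSwinnertonDyer.Theorems.KimAtThreeShallowEqDeepPositionDefs
open Summit.BirchSwinnertonDyer.BirchSwinnertonDyer.Theorems.KimAtThreeShallowEqDeepPositionRescaleDefs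
open Summit.BirchSwinnertonDyer.BirchSwinnertonDyer.Theorems.KimAtThreeShallowEqDeepPositionScaling

namespace Summit.BirchSwinnertonDyer.BirchSwinnertonDyer.Theorems.KimAtThreeShallowEqDeepPositionRescale

/-! ### §1 Pure logic: from the inequality to an exact shift -/

/-- Pure logic behind the inequality ⟹ equality direction: if `v ≤ val e` for every admissible `e` (`nz e ∧ Prem e`) and all
admissible `e` have the same `val`, then ONE natural shift `m` achieves `v + m = val e` for every admissible `e` (`m = 0` if none
exists). -/
theorem exists_add_eq_of_le_of_rigid {K : Type*} (nz Prem : K → Prop) (val : K → ℤ) (v : ℤ)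
    (hle : ∀ e, nz e → Prem e → v ≤ val e)
    (hrigid : ∀ e e', nz e → nz e' → Prem e → Prem e' → val e = val e') :
    ∃ m : ℕ, ∀ e, nz e → Prem e → v + m = val e := by
  by_cases hex : ∃ e, nz e ∧ Prem e
  · obtain ⟨e₀, he₀, hp₀⟩ := hex
    obtain ⟨m, hm⟩ := Int.eq_ofNat_of_zero_le (sub_nonneg.mpr (hle e₀ he₀ hp₀))
    exact ⟨m, fun e he hp => by rw [hrigid e e₀ he he₀ hp hp₀]; omega⟩
  · exact ⟨0, fun e he hp => absurd ⟨e, he, hp⟩ hex⟩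

/-! ### §2 Item 21401 ⟺ its «up to a power of 3» form -/

set_option backward.isDefEq.respectTransparency false in
/-- **`KatoPeriodPositionAtThree` (route item 21401) ⟺ `KatoPeriodPositionUpToPowAtThree`** (position of the constant up to a
power of `3`): (⟹) `m = 0`; (⟸) rescale Kato's datum by `3^m` — the matrix is closed under it
(`KimAtThreeShallowEqDeepPositionScaling.definedExpStarBody_natCast_mul`) and the rescaled constant `3^m·κK` is in position.  TOOL /
reading-level; neither side is proved here; BSD is not proved by this.
[cite: Kato2004Asterisque, (8.1.3) (p. 180), §9.4 (p. 188), Thm. 9.7 (p. 189), Thm. 6.6 (1) (p. 163), Ex. 13.3 (pp. 224–225)]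
[cite: BlochKato1990, Def. 3.10 and Prop. 3.8] -/
theorem katoPeriodPositionAtThree_iff_upToPow : KatoPeriodPositionAtThree ↔ KatoPeriodPositionUpToPowAtThree := by
  constructor
  · intro h W _ _ _ _ _ htow N _ P hN hlat
    obtain ⟨d, ι, κK, Λ, hκ, hpos, hbody⟩ := h W htow P hN hlat
    exact ⟨d, ι, κK, Λ, hκ, ⟨0, by rwa [pow_zero, Nat.cast_one, one_mul]⟩, hbody⟩
  · intro h W _ _ _ _ _ htow N _ P hN hlat
    obtain ⟨d, ι, κK, Λ, hκ, ⟨m, hpos⟩, hbody⟩ := h W htow P hN hlat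
    exact ⟨d, ι, ((3 ^ m : ℕ) : ℝ) * κK, Λ, mul_ne_zero (by positivity) hκ, hpos,
      definedExpStarBody_natCast_mul W 3 P.f ι κK Λ (3 ^ m) hbody⟩

/-! ### §3 Item 21401 ⟺ its INEQUALITY form -/

set_option backward.isDefEq.respectTransparency false in
/-- **`KatoPeriodPositionAtThree` (route item 21401) ⟺ `KatoPeriodPositionLEAtThree`** — the displayed EQUALITY `v_3(u) = v(ι_3 e)`
of the position clause is equivalent, inside Kato's `∃ (d ι κK Λ)`, to the INEQUALITY `v_3(u) ≤ v(ι_3 e)` («Kato's constant is at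
most as 3-divisible as the duality scalar», the normalisation exponent `e(Ω⁺_f) ≥ 0` of crux 19077's docstring).  (⟹) `le_of_eq`.
(⟸) all duality-normalising scalars of the line `d` have ONE valuation `v₀` (rigidity,
`KimAtThreeShallowEqDeepPositionScaling.valuation_eq_of_forall_exists_eq_mul_iff_ball` — the duality ball is an honest ball); with
`m := v₀ − v_3(u) ≥ 0` (`exists_add_eq_of_le_of_rigid`) the datum rescaled by `3^m` (`definedExpStarBody_natCast_mul`) has its
constant `3^m·u` in position EXACTLY.  TOOL / reading-level; neither side is proved; nothing booked; BSD is not proved by this.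
[cite: Kato2004Asterisque, (8.1.3) (p. 180), §9.4 (p. 188), Thm. 9.7 (p. 189), Thm. 6.6 (1) (p. 163), Ex. 13.3 (pp. 224–225)]
[cite: BlochKato1990, Def. 3.10 and Prop. 3.8] [cite: SilvermanAEC2009, IV.6.4 and VII.6.3] -/
theorem katoPeriodPositionAtThree_iff_le : KatoPeriodPositionAtThree ↔ KatoPeriodPositionLEAtThree := by
  constructor
  · intro h W _ _ _ _ _ htow N _ P hN hlat
    obtain ⟨d, ι, κK, Λ, hκ, hpos, hbody⟩ := h W htow P hN hlat
    obtain ⟨u, hu, heq⟩ := hpos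
    exact ⟨d, ι, κK, Λ, hκ, ⟨u, hu, fun e he hprem => (heq e he hprem).le⟩, hbody⟩
  · intro h W _ _ _ _ _ htow N _ P hN hlat
    obtain ⟨d, ι, κK, Λ, hκ, hle, hbody⟩ := h W htow P hN hlat
    obtain ⟨u, hu, hle⟩ := hle
    have hu0 : u ≠ 0 := by
      rintro rfl
      exact hκ (by rw [← hu]; norm_num)
    -- one natural shift `m` with `v_3(u) + m = v(ι_3 e)` for every duality-normalising `e` (rigidity of the duality scalar)
    obtain ⟨m, hm⟩ := exists_add_eq_of_le_of_rigid _ _ _ _ hle fun e e' he he' hp hp' =>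
      valuation_eq_of_forall_exists_eq_mul_iff_ball W 3 _ ((map_ne_zero_iff _ (RingHom.injective _)).mpr he)
        ((map_ne_zero_iff _ (RingHom.injective _)).mpr he') hp hp'
    have h33 : padicValRat 3 (3 : ℚ) = 1 := by
      have h := padicValRat.self (p := 3) (by norm_num)
      simpa using h
    -- the datum rescaled by `3^m`: constant `3^m·κK = 3^m·u`, in position exactly
    refine ⟨d, ι, ((3 ^ m : ℕ) : ℝ) * κK, Λ, mul_ne_zero (by positivity) hκ,
      ⟨(3 : ℚ) ^ m * u, by rw [← hu, Rat.cast_mul, Rat.cast_pow, Rat.cast_ofNat, Nat.cast_pow, Nat.cast_ofNat],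
        fun e he hprem => ?_⟩,
      definedExpStarBody_natCast_mul W 3 P.f ι κK Λ (3 ^ m) hbody⟩
    refine Eq.trans ?_ (hm e he hprem)
    rw [padicValRat.mul (pow_ne_zero m (by norm_num)) hu0, padicValRat.pow (3 : ℚ), h33]
    ring

/-- **The ROUTE ITEM `KatoPeriodPositionThree` (stmt-BirchSwinnertonDyer-21401) ⟺ its INEQUALITY form `KatoPeriodPositionLEAtThree`**
(`katoPeriodPositionAtThree_iff_le`; the item decl IS `KatoPeriodPositionAtThree`, `KimAtThreeShallowEqDeepOfPeriodPositionItem.katoPeriodPositionThree_iff`).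
READING for the route card: the one displayed non-cite statement of W2 can be read as the inequality `e(Ω⁺_f) ≥ 0` — no extra content in
the «=».  TOOL; the item stays OPEN; nothing booked; BSD is not proved by this.
[cite: Kato2004Asterisque, §9.4 (p. 188), Thm. 9.7 (p. 189)] [cite: BlochKato1990, Def. 3.10 and Prop. 3.8] -/
theorem katoPeriodPositionThree_iff_le :
    Summit.BirchSwinnertonDyer.BirchSwinnertonDyer.Theses.KimAtThreeKolyvagin.KatoPeriodPositionThree ↔
      KatoPeriodPositionLEAtThree :=
  katoPeriodPositionAtThree_iff_le

/-- **The ROUTE ITEM `KatoPeriodPositionThree` ⟺ `KatoPeriodPositionUpToPowAtThree`** (position up to a power of `3`;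
`katoPeriodPositionAtThree_iff_upToPow`).  TOOL; the item stays OPEN; nothing booked.
[cite: Kato2004Asterisque, §9.4 (p. 188), Thm. 9.7 (p. 189)] -/
theorem katoPeriodPositionThree_iff_upToPow :
    Summit.BirchSwinnertonDyer.BirchSwinnertonDyer.Theses.KimAtThreeKolyvagin.KatoPeriodPositionThree ↔
      KatoPeriodPositionUpToPowAtThree :=
  katoPeriodPositionAtThree_iff_upToPow

end Summit.BirchSwinnertonDyer.BirchSwinnertonDyer.Theorems.KimAtThreeShallowEqDeepPositionRescale

end
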